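import Summits.CriticalPhenomena.CardyFormulaZ2.Theses.CardyUniqueLimit
import Summits.CriticalPhenomena.CardyFormulaZ2.Theorems.CardyUniqueLimitCardyRigidityStubKernelFacts
import Summits.CriticalPhenomena.CardyFormulaZ2.Theorems.CardyUniqueLimitCardyRigidityMvpRigidity
import HarnessLib

/-!
# Line `frozen_hull` for crux `CardyRigidity` (stmt-CriticalPhenomena-0746) — strategist s1, ALTERNATIVE line

Crux (shared `Prop` of nine CardyFormulaZ2 routes; registrar decl
`Summit.CriticalPhenomena.CardyFormulaZ2.Theses.CardyUniqueLimit.CardyRigidity`):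

    ∀ f, (∀ R : ConformalRectangle, R.HasCrossingLimit (bondDomainCrossingProb R) f) → EqOn f cardyFunction (Ioo 0 1).

IDEA (one-step / frozen-hull far-field identity).  The live line `crossing_martingale` runs the whole
chordal Loewner evolution of a subsequential interface limit (driver `W_t`, capacity clock, level stopping)
and is stuck on the Kemppainen–Smirnov inputs (A1 `stub_percBoxTight`, A2‴ `stub_percFaceAnnulusTransfer`).
But the landed analysis half `Mvp.affineCardy_of_mvpData` consumes only ONE-STEP LAWS `ν_n` at mark scale
`n`: an exact mean-value identity `∫ f(η̂ + x) dν_n = f η̂` plus first/second moment asymptotics.  Such laws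
come from a SINGLE geometric stopping time, with no driver at all: explore the bond-`ℤ²` interface from the
corner `0` (in half-plane coordinates) until it first EXITS the unit half-disc, freeze, and read the hull
`K ⊂ B̄(0,2)` through its hydrodynamic map `g_K` (`Literature…HydrodynamicMaps`: `IsHydrodynamicMap`,
`reflExt`, `hcap`, far-field expansion `|g_K(x) - x - hcap/x| ≤ 6·hcap·r/x²`) and the tip image
`W = g_K(tip)`.  Domain Markov (landed `Freezing.percSlitExpectation_frozen`, `EventIdentity`) gives the
exact identity `P_δ(Q_s) = E_δ[P_δ(slit crossing)]` for the rectangle `(ℍ; 0, sa, sb, sc)` at EVERY scale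
`s`; the all-rectangle hypothesis evaluates the left side (`→ f(cardyEta a b c)`, scale invariance of
`cardyEta`) and — the heart, now at ONE stopping time with marks FAR from the frozen hull — the slit crossing
probability (`≈ f(cardyEta(g_K(sa)-W, g_K(sb)-W, g_K(sc)-W))`).  Bounded scalars `(W, hcap, g_K(x))` need no
tightness theory; the deterministic expansion `g_K(sx)/s = x + (hcap/s²)/x - W/s·0 + O(s⁻³)` puts the marks
in the exact format of the landed `FarField.abs_cardyEta_perturbed_sub_le`, and with `λ² = E[hcap]/2`,
`s = nλ`, `m = E[W]/λ`, `v = E[W²]/λ²` the subsequential laws of `η_s - η̂` are `MvpData f m v`.  Then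
`Mvp.affineCardy_of_mvpData` gives `f = A·I_{2/3} + B` and the boundary values (`stub_kernelFacts`, landed)
pin `A = 1`, `B = 0` exactly as in the live skeleton.

STUBS (the only `sorry`s): `stub_percFrozenHull` (F1, percolation, XL: frozen Markov identity + far-mark
slit uniformity + hull pull-back + `E hcap > 0` by RSW) and `stub_mvpData_of_frozenHull` (F2, probability /
analysis, M: Prokhorov on `[-r_n, r_n]` + expectations of the landed pathwise expansion).  Composition
`CardyRigidity_of` is sorry-free and concludes the crux BY NAME.
-/

noncomputable section

open MeasureTheory Filter Set Topology
open Literature.Probability.RandomPlanarGeometry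
open Literature.Probability.Percolation (bondDomainCrossingProb)
open Summit.CriticalPhenomena.CardyFormulaZ2.Cruxes.CardyRigidity.CrossingMartingale
  (AllRectangleKernel betaLaw betaLaw_two_thirds incBeta13_one_ne_zero tendsto_betaLaw_two_thirds_zero
    tendsto_betaLaw_two_thirds_one stub_kernelFacts)

namespace Summit.CriticalPhenomena.CardyFormulaZ2.Cruxes.CardyRigidity.FrozenHull

/-! ### The two interfaces of the line -/

/-- **Frozen-hull approximation data for the kernel `f`** (output of the percolation half F1, input of
F2).  Along a mesh sequence (index `k → ∞`) there are probability spaces carrying the FROZEN HULL DATA of the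
bond-`ℤ²` exploration stopped on first exit from the unit half-disc, in half-plane coordinates: the tip image
`W_k = g_K(tip)`, the half-plane capacity `C_k = hcap K` and the far boundary values `G_k(x) = g_K(x)`,
`x ≥ R`, of the hydrodynamic map of the hull — all bounded by one constant `R`, with the hydrodynamic
far-field bound `|G(x) - x - C/x| ≤ R/x²`, convergent scalar moments `E W_k → EW`, `E W_k² → EW2`,
`E C_k → EC > 0` (non-degeneracy: the hull swallows a fixed half-disc with probability bounded below, RSW) —
such that for every shape `0 < a < b < c` and every large scale `s` the FROZEN MARKOV IDENTITY passes to the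
limit: `E_k[f(cardyEta(G_k(sa) - W_k, G_k(sb) - W_k, G_k(sc) - W_k))] → f(cardyEta a b c)` (left side =
`P_k`(crossing of `(ℍ; 0, sa, sb, sc)`) by domain Markov + far-mark slit uniformity; right side by the
all-rectangle hypothesis and scale invariance of `cardyEta`). [folklore] -/
def PercFrozenHullApprox (f : ℝ → ℝ) : Prop :=
  ∃ (Ω : ℕ → Type) (_ : ∀ k, MeasurableSpace (Ω k)) (μ : ∀ k, Measure (Ω k))
    (_ : ∀ k, IsProbabilityMeasure (μ k)) (W C : ∀ k, Ω k → ℝ) (G : ∀ k, Ω k → ℝ → ℝ)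
    (R EW EW2 EC : ℝ),
    (∀ k, Measurable (W k)) ∧ (∀ k, Measurable (C k)) ∧ (∀ k x, Measurable fun ω ↦ G k ω x) ∧
    (∀ k ω, |W k ω| ≤ R) ∧ (∀ k ω, 0 ≤ C k ω ∧ C k ω ≤ R) ∧
    (∀ k ω x, R ≤ x → |G k ω x - x - C k ω / x| ≤ R / x ^ 2) ∧
    Tendsto (fun k ↦ ∫ ω, W k ω ∂μ k) atTop (𝓝 EW) ∧
    Tendsto (fun k ↦ ∫ ω, (W k ω) ^ 2 ∂μ k) atTop (𝓝 EW2) ∧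
    Tendsto (fun k ↦ ∫ ω, C k ω ∂μ k) atTop (𝓝 EC) ∧ 0 < EC ∧
    ∀ a b c : ℝ, 0 < a → a < b → b < c → ∃ s₀ : ℝ, ∀ s : ℝ, s₀ ≤ s →
      Tendsto (fun k ↦ ∫ ω, f (cardyEta (G k ω (s * a) - W k ω) (G k ω (s * b) - W k ω)
        (G k ω (s * c) - W k ω)) ∂μ k) atTop (𝓝 (f (cardyEta a b c)))

/-- **Asymptotic mean-value data** of `f` with parameters `(m, v)`: verbatim the hypothesis `hdata` of the
landed `Mvp.affineCardy_of_mvpData` (one-step laws `ν_n` at mark scale `n`, exact identity, moment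
asymptotics). [cite: LawlerSchrammWerner2001, §3] -/
def MvpData (f : ℝ → ℝ) (m v : ℝ) : Prop :=
  ∀ a b c : ℝ, 0 < a → a < b → b < c →
    ∃ (r : ℕ → ℝ) (ν : ℕ → Measure ℝ) (L₁ L₂ M₁ : ℝ), Tendsto r atTop (𝓝 0) ∧
      (∀ᶠ n in atTop, IsProbabilityMeasure (ν n) ∧ ν n (Icc (-(r n)) (r n))ᶜ = 0 ∧
        ∫ x, f (cardyEta a b c + x) ∂(ν n) = f (cardyEta a b c)) ∧
      Tendsto (fun n : ℕ ↦ (n : ℝ) * ∫ x, x ∂(ν n)) atTop (𝓝 L₁) ∧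
      Tendsto (fun n : ℕ ↦ (n : ℝ) ^ 2 * ∫ x, x ^ 2 ∂(ν n)) atTop (𝓝 L₂) ∧
      (m = 0 → Tendsto (fun n : ℕ ↦ (n : ℝ) ^ 2 * ∫ x, x ∂(ν n)) atTop (𝓝 M₁)) ∧
      L₁ = -((c - b) * (b - a) / ((c - a) * b ^ 2)) * m ∧
      L₂ = ((c - b) * (b - a) / ((c - a) * b ^ 2)) ^ 2 * v ∧
      M₁ = 2 * (a⁻¹ + b⁻¹ + c⁻¹) * ((c - b) * (b - a) / ((c - a) * b ^ 2)) +
        v / 2 * (-2 * ((c - b) * (b - a)) / ((c - a) * b ^ 3))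

/-! ### The registered stubs -/

/-- **STUB F1 (percolation, XL) — frozen-hull data under the all-rectangle hypothesis.**  For the
bond-`ℤ²` exploration in a Dobrushin discretisation of `(φ(ℍ); φ(0), φ(∞))` stopped at the first exit
from `φ(B(0,1) ∩ ℍ)`: (i) exact frozen Markov identity `P(Q_s) = E[P(slit crossing | prefix)]`
(landed: `Freezing.percSlitExpectation_frozen`, `EventIdentity.*`; marks `s·(a,b,c)` with `s a > 2` are
never approached, so no level stopping is needed); (ii) `P(Q_s) → f(cardyEta a b c)` (hypothesis at the
fixed rectangle `(φ(ℍ); φ 0, φ(sa), φ(sb), φ(sc))`, `cardyEta_mul`); (iii) THE HEART at one stopping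
time: the conditional slit-crossing probability is within `o(1)` in `L¹` of
`f(cardyEta(g_K(sa) - W, g_K(sb) - W, g_K(sc) - W))` (Camia–Newman flower sandwich — landed
`slitCrossing_discreteCrossing_subset_of_margins`, `Squeeze`, `Bulk`, `TipNegligible` — over a finite
`ε`-net of bracket rectangles given by Aizenman–Burchard precompactness of the stopped interface; far marks
make tip/fjord defects cost a one-arm event); (iv) hull pull-back and bounds (`IsHydrodynamicMap.reflExt`,
`hcap_le`, `norm_sub_self_le`, `norm_sub_sub_div_le`; `W`, `hcap`, `g_K(x)` are bounded scalars, so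
convergence of `E W`, `E W²`, `E hcap` is Bolzano–Weierstrass along a sub-mesh-sequence); (v) `E hcap ≥ c₀`
(RSW: the half-disc `B̄(0,1/2) ∩ ℍ` is swallowed with probability `≥ p₀`; `hcapOf_mono`,
`HalfDiscCapacity`).  Why plausibly true: (i),(ii),(iv),(v) are theorems/RSW; (iii) is CN07 Thm 3's
continuity step specialised to one frozen hull with far marks. [cite: CamiaNewman2007, Thm 3, Lemma 7.3] -/
theorem stub_percFrozenHull : ∀ f : ℝ → ℝ, AllRectangleKernel f → PercFrozenHullApprox f := by
  sorry

/-- **STUB F2 (probability/analysis, M) — frozen-hull data give the asymptotic mean-value package.**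
With `λ := √(EC/2)`, `m := EW/λ`, `v := EW2/λ²` and, for a shape `(a,b,c)` and `n ≥ 1`, `ν_n` := a
subsequential weak limit (Prokhorov on the compact interval `[-r_n, r_n]`, `r_n = O(1/n)`; tree:
`Literature.Analysis.FluidPDE.exists_subseq_tendsto_finiteMeasure_of_isCompact`) of the laws of
`h_{n,k} = cardyEta(G_k(nλa) - W_k, …) - cardyEta a b c`: the exact identity passes to the limit because
`x ↦ f(η̂ + x)` is continuous on `[-r_n, r_n] ⊂ (0,1) - η̂`; the moments by taking expectations in the
landed DETERMINISTIC expansion `FarField.abs_cardyEta_perturbed_sub_le` with drift `r = C_k/(nλ)²`, shift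
`s = W_k/(nλ)`, errors `|εᵢ| ≤ R/((nλ)³ xᵢ²)` (all surely bounded — no `L³` theory), the drift sequence by
`FarField.farField_hasDerivAt_cardyEta_drift`, and `E C_k/λ² → 2`.  Why plausibly true: it is the
one-step analogue of the landed `FarField.mvp_package`, with bounded data. [cite: LawlerSchrammWerner2001, §3] -/
theorem stub_mvpData_of_frozenHull : ∀ f : ℝ → ℝ, ContinuousOn f (Ioo 0 1) →
    PercFrozenHullApprox f → ∃ m v : ℝ, 0 ≤ v ∧ MvpData f m v := by
  sorry

/-! ### The composition (sorry-free): the crux from F1, F2 and the landed kernel facts / MVP rigidity -/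

/-- **The reduction of line `frozen_hull` (sorry-free), hypotheses = the two stub STATEMENTS verbatim,
conclusion = the crux unfolded.**  Kernel facts (landed `stub_kernelFacts`) give continuity and the boundary
values; F1 and F2 give `MvpData f m v`; the landed asymptotic mean-value rigidity `Mvp.affineCardy_of_mvpData`
gives `f = A·I_{2/3} + B` on `(0,1)`; the boundary values force `B = 0`, `A = 1`, and `I_{2/3} = cardyFunction`
(`betaLaw_two_thirds`, `cardyFunction_eq_incBeta13_div_holds`). [folklore] -/
theorem frozenHull_reduction
    (hF1 : ∀ f : ℝ → ℝ, AllRectangleKernel f → PercFrozenHullApprox f)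
    (hF2 : ∀ f : ℝ → ℝ, ContinuousOn f (Ioo 0 1) → PercFrozenHullApprox f → ∃ m v : ℝ, 0 ≤ v ∧ MvpData f m v) :
    ∀ f : ℝ → ℝ, AllRectangleKernel f → EqOn f cardyFunction (Ioo 0 1) := by
  intro f hf
  -- landed kernel facts: continuity on (0,1) and the boundary values 0, 1
  obtain ⟨hcont, hf0, hf1⟩ := stub_kernelFacts f hf
  -- F1: frozen-hull data; F2: the asymptotic mean-value package
  obtain ⟨m, v, hv, hdata⟩ := hF2 f hcont (hF1 f hf)
  -- landed MVP rigidity: `f` is affine in `I_{2/3}` on (0,1)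
  obtain ⟨A, B, hfab⟩ :=
    Summit.CriticalPhenomena.CardyFormulaZ2.Cruxes.CardyRigidity.CrossingMartingale.Mvp.affineCardy_of_mvpData
      hcont hv hdata
  -- the boundary values of `f` along the affine form: `B = 0`, `A = 1`
  have hev0 : ∀ᶠ η in 𝓝[>] (0 : ℝ), f η = A * betaLaw (2 / 3) η + B :=
    Filter.eventually_of_mem (Ioo_mem_nhdsGT zero_lt_one) fun η hη ↦ hfab hη
  have hev1 : ∀ᶠ η in 𝓝[<] (1 : ℝ), f η = A * betaLaw (2 / 3) η + B :=
    Filter.eventually_of_mem (Ioo_mem_nhdsLT zero_lt_one) fun η hη ↦ hfab hη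
  have hlim0 : Tendsto f (𝓝[>] 0) (𝓝 (A * 0 + B)) :=
    ((tendsto_betaLaw_two_thirds_zero.const_mul A).add_const B).congr'
      (hev0.mono fun η hη ↦ hη.symm)
  have hlim1 : Tendsto f (𝓝[<] 1) (𝓝 (A * 1 + B)) :=
    ((tendsto_betaLaw_two_thirds_one.const_mul A).add_const B).congr'
      (hev1.mono fun η hη ↦ hη.symm)
  have hB0 : B = 0 := by
    have := tendsto_nhds_unique hlim0 hf0
    simpa using this
  have hA1 : A = 1 := by
    have := tendsto_nhds_unique hlim1 hf1
    rw [hB0] at this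
    simpa using this
  -- conclusion: `f = I_{2/3} = F` on (0,1)
  intro η hη
  have hfη : f η = A * betaLaw (2 / 3) η + B := hfab hη
  rw [hfη, hA1, hB0, one_mul, add_zero, betaLaw_two_thirds]
  exact (cardyFunction_eq_incBeta13_div_holds η (Ioo_subset_Icc_self hη)).symm

/-- **The crux from the stubs of line `frozen_hull`** — `frozenHull_reduction` applied to the two declared
stubs; concludes the registered crux decl BY NAME (the only `sorry`s of this file are inside
`stub_percFrozenHull` and `stub_mvpData_of_frozenHull`). [folklore] -/
theorem CardyRigidity_of :
    Summit.CriticalPhenomena.CardyFormulaZ2.Theses.CardyUniqueLimit.CardyRigidity :=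
  fun f hf => frozenHull_reduction stub_percFrozenHull stub_mvpData_of_frozenHull f hf

end Summit.CriticalPhenomena.CardyFormulaZ2.Cruxes.CardyRigidity.FrozenHull

end
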